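import Summits.ResolutionOfSingularities.ResolutionOfSingularities.Theorems.EquisingularLiftEquisingularLiftNatNoLevelMark
import HarnessLib

/-!
# [OURS] THE WHOLE NON-SIMPLE TAIL OF THE SERIES `x² + y³ + z^k`: for EVERY `k ≥ 6` the isolated double point `x² + y³ + z^k` has NO finite blow-up depth
# in any blow-up tower (every field) — exactly the members of the series that are not rational double points (`k ≤ 5`: `A₂, D₄, E₆, E₈`)
# (cruxes `Theses.EquisingularLift.EquisingularLiftNat` / `…NatThree` / `EquisingularLift`, stmt-ResolutionOfSingularities-20038 / -20148 / -15660)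

[OURS · leafhand-res-equisingularlift-12 g1, 2026-09-01; cell `pub/decomp-res`] AI-produced, weaker than expert review; NOT a statement of any manuscript;
nothing here proves resolution of singularities in positive characteristic.  DEF-FREE helper; no `sorry`; standard axioms; ZERO named hypotheses.

Parametric form of ✓ `towerLevel_none_origin_E12blowup` / ✓ `towerLevel_none_origin_E12` (`k = 7`): with `x := y₂`, `y := y₀`, `z := y₁` and `k = j + 6`,
chart `1` of `x² + y³ + z^{j+6}` carries `g_j = x² + y³z + z^{j+4}` at its origin, and chart `1` of `g_j` carries `T₂² + T₁²(T₀³ + T₁^j) ∈ (T₁, T₂)²` — a strict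
transform singular along the LINE `T₁ = T₂ = 0` of the exceptional divisor.  (`k = 6` is the simple elliptic `Ẽ₈`; `k = 7, 8, 9` are `E₁₂, E₁₃`-adjacent
unimodal points; none of them is absolutely isolated — in the depth programme's currency: no level.)

* `OneStep.x2y3z_blowup_strictTransform₁`, `x2y3zk_strictTransform₁` — the two chart identities;
* ★★★ `OneStep.towerLevel_none_origin_x2y3z_blowup` — `y₂² + y₀³y₁ + y₁^{j+4}` has no `D`-level (✓ `towerLevel_none_origin_of_mem_sq`);
* ★★★ `OneStep.towerLevel_none_origin_x2y3zk` — `y₂² + y₀³ + y₁^{j+6}` has no `D`-level, every `j`, every field (✓ `towerLevel_none_origin_of_mark`).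

Honest consequence: together with the ADE depth table (✓ …NatAOddTower/AEvenTower/DEvenTower/DOddTower/E6Tower/ESeriesTower) this is the normal-form
shadow of «absolutely isolated double points = rational double points» in the route's tower currency.  Closes no registered stub.

References: [StacksProject, Tags 0804, 080E]; [Matsumura1987, Thm. 14.2]; [Lipman1969, §24]; [Hartshorne1977, II Ex. 7.12]; through the cited tree files.
-/

set_option linter.dupNamespace false -- mandated namespace `Summit.<Summit>.<Problem>` of this single-conjunct summit

noncomputable section

open CategoryTheory CategoryTheory.Limits AlgebraicGeometry TopologicalSpace Topology
open MvPolynomial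
open Literature.AlgebraicGeometry.Resolution
open AlgebraicGeometry.Scheme.IdealSheafData

namespace Summit.ResolutionOfSingularities.ResolutionOfSingularities.Cruxes.EquisingularLiftNat.Sections

namespace OneStep

variable (K : Type) [Field K]

/-- **Chart `1` of `g_j = y₂² + (y₀³y₁ + y₁^{j+4})`**: `T₁²·(T₂² + T₁²(T₀³ + T₁^j))`. [cite: Hartshorne1977, II Ex. 7.12] -/
theorem x2y3z_blowup_strictTransform₁ (j : ℕ) :
    aeval (fun i => X 1 * Function.update (X : Fin 3 → MvPolynomial (Fin 3) K) 1 1 i)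
        (X 2 ^ 2 + (X 0 ^ 3 * X 1 + X 1 ^ (j + 4)) : MvPolynomial (Fin 3) K) = X 1 ^ 2 * (X 2 ^ 2 + X 1 ^ 2 * (X 0 ^ 3 + X 1 ^ j)) := by
  simp only [map_add, map_mul, map_pow, aeval_X, Function.update_self, Function.update_of_ne (by decide : (0 : Fin 3) ≠ 1),
    Function.update_of_ne (by decide : (2 : Fin 3) ≠ 1)]
  ring

/-- **Chart `1` of `y₂² + (y₀³ + y₁^{j+6})`**: `T₁²·(T₂² + (T₀³T₁ + T₁^{j+4}))` — the point `g_j`. [cite: Hartshorne1977, II Ex. 7.12] -/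
theorem x2y3zk_strictTransform₁ (j : ℕ) :
    aeval (fun i => X 1 * Function.update (X : Fin 3 → MvPolynomial (Fin 3) K) 1 1 i)
        (X 2 ^ 2 + (X 0 ^ 3 + X 1 ^ (j + 6)) : MvPolynomial (Fin 3) K) = X 1 ^ 2 * (X 2 ^ 2 + (X 0 ^ 3 * X 1 + X 1 ^ (j + 4))) := by
  simp only [map_add, map_pow, aeval_X, Function.update_self, Function.update_of_ne (by decide : (0 : Fin 3) ≠ 1),
    Function.update_of_ne (by decide : (2 : Fin 3) ≠ 1)]
  ring

/-- ★★★ **`x² + y³z + z^{j+4}` HAS NO BLOW-UP DEPTH** (every `j`, every field, every blow-up tower). [OURS] [cite: StacksProject, Tag 0804]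
[cite: Matsumura1987, Thm. 14.2] -/
theorem towerLevel_none_origin_x2y3z_blowup (D : ℕ → ∀ Γ : Scheme.{0}, Γ → Prop)
    (hD0 : ∀ (Γ : Scheme.{0}) (y : Γ), IsClosed (({y} : Set Γ)) →
      (D 0 Γ y ↔ ∀ (hy : IsClosed (({y} : Set Γ))) (Z : Scheme.{0}) (τ : Z ⟶ Γ), IsBlowup τ (vanishingIdeal ⟨{y}, hy⟩) →
        ∀ z : Z, τ z = y → IsRegularLocalRing (Z.presheaf.stalk z)))
    (hDsucc : ∀ (d : ℕ) (Γ : Scheme.{0}) (y : Γ), IsClosed (({y} : Set Γ)) →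
      (D (d + 1) Γ y ↔ ∀ (hy : IsClosed (({y} : Set Γ))) (Z : Scheme.{0}) (τ : Z ⟶ Γ), IsBlowup τ (vanishingIdeal ⟨{y}, hy⟩) →
        ∃ S' : Finset Z, (∀ z : Z, τ z = y → z ∉ S' → IsRegularLocalRing (Z.presheaf.stalk z)) ∧
          ∀ z ∈ S', τ z = y ∧ IsClosed (({z} : Set Z)) ∧ ∃ d' ≤ d, D d' Z z)) (j : ℕ) :
    ∀ (f : MvPolynomial (Fin 3) K), f = X 0 ^ 3 * X 1 + X 1 ^ (j + 4) + X 2 ^ 2 →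
      ∀ (y₀ : Spec (CommRingCat.of (MvPolynomial (Fin 3) K ⧸ Ideal.span {f}))),
        y₀.asIdeal = Ideal.map (Ideal.Quotient.mk (Ideal.span {f})) (Ideal.span (Set.range (X : Fin 3 → MvPolynomial (Fin 3) K))) →
        ∀ n, ¬ D n (Spec (CommRingCat.of (MvPolynomial (Fin 3) K ⧸ Ideal.span {f}))) y₀ := by
  classical
  intro f hf y₀ hy₀ n
  have e : (X 2 ^ 2 : MvPolynomial (Fin 3) K) + (X 0 ^ 3 * X 1 + X 1 ^ (j + 4)) = f := by rw [hf]; ring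
  subst e
  have hΦ : (X 2 ^ 2 : MvPolynomial (Fin 3) K).IsHomogeneous 2 := isHomogeneous_X_pow (2 : Fin 3) 2
  have hΦ0 : (X 2 ^ 2 : MvPolynomial (Fin 3) K) ≠ 0 := pow_ne_zero _ (X_ne_zero 2)
  have hΨ : (X 0 ^ 3 * X 1 + X 1 ^ (j + 4) : MvPolynomial (Fin 3) K) ∈ Ideal.span (Set.range (X : Fin 3 → MvPolynomial (Fin 3) K)) ^ (2 + 1) := by
    refine Ideal.add_mem _ ?_ ?_
    · simpa using SecondOrderPoint.monomial_mem_pow₃ K 3 1 0 (k := 2 + 1) (by norm_num)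
    · simpa using SecondOrderPoint.monomial_mem_pow₃ K 0 (j + 4) 0 (k := 2 + 1) (by omega)
  let P : Ideal (MvPolynomial (Fin 3) K) := Ideal.span (X '' ({1, 2} : Set (Fin 3)))
  haveI hP : P.IsPrime := Literature.RingTheory.MvPolynomial.isPrime_span_X_image _
  have hX1 : (X 1 : MvPolynomial (Fin 3) K) ∈ P := Literature.RingTheory.MvPolynomial.X_mem_span_X_image_iff.mpr (by simp)
  have hX2 : (X 2 : MvPolynomial (Fin 3) K) ∈ P := Literature.RingTheory.MvPolynomial.X_mem_span_X_image_iff.mpr (by simp)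
  have hX0 : (X 0 : MvPolynomial (Fin 3) K) ∉ P := fun h =>
    absurd (Literature.RingTheory.MvPolynomial.X_mem_span_X_image_iff.mp h) (by simp)
  have hPmax : ¬ P.IsMaximal := by
    intro hM
    let Q : Ideal (MvPolynomial (Fin 3) K) := Ideal.span (X '' (Set.univ : Set (Fin 3)))
    haveI hQ : Q.IsPrime := Literature.RingTheory.MvPolynomial.isPrime_span_X_image _
    have hPQ : P ≤ Q := Ideal.span_mono (Set.image_mono (Set.subset_univ _))
    have hEq : P = Q := hM.eq_of_le hQ.ne_top hPQ
    exact hX0 (hEq ▸ Literature.RingTheory.MvPolynomial.X_mem_span_X_image_iff.mpr (Set.mem_univ _))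
  have hGP : (X 2 ^ 2 + X 1 ^ 2 * (X 0 ^ 3 + X 1 ^ j) : MvPolynomial (Fin 3) K) ∈ P ^ 2 :=
    Ideal.add_mem _ (Ideal.pow_mem_pow hX2 2) (Ideal.mul_mem_right _ _ (Ideal.pow_mem_pow hX1 2))
  have hG0 : (X 2 ^ 2 + X 1 ^ 2 * (X 0 ^ 3 + X 1 ^ j) : MvPolynomial (Fin 3) K) ≠ 0 := by
    intro h
    have h1 := congrArg (eval (Pi.single (2 : Fin 3) (1 : K))) h
    simp at h1
  exact towerLevel_none_origin_of_mem_sq K D hD0 hDsucc (X 2 ^ 2) (X 0 ^ 3 * X 1 + X 1 ^ (j + 4)) (by norm_num) hΦ hΦ0 hΨ 1 _ hG0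
    (x2y3z_blowup_strictTransform₁ K j) P hPmax hX1 hGP y₀ hy₀ n

/-- ★★★ **`x² + y³ + z^k` HAS NO BLOW-UP DEPTH FOR EVERY `k ≥ 6`** (every field, every blow-up tower): for every `j` and every `f = y₀³ + y₁^{j+6} + y₂²`, the
origin of `Spec K[y]/(f)` has no `D`-level. [OURS] [cite: StacksProject, Tags 0804, 080E] [cite: Matsumura1987, Thm. 14.2] [cite: Lipman1969, §24] -/
theorem towerLevel_none_origin_x2y3zk (D : ℕ → ∀ Γ : Scheme.{0}, Γ → Prop)
    (hD0 : ∀ (Γ : Scheme.{0}) (y : Γ), IsClosed (({y} : Set Γ)) →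
      (D 0 Γ y ↔ ∀ (hy : IsClosed (({y} : Set Γ))) (Z : Scheme.{0}) (τ : Z ⟶ Γ), IsBlowup τ (vanishingIdeal ⟨{y}, hy⟩) →
        ∀ z : Z, τ z = y → IsRegularLocalRing (Z.presheaf.stalk z)))
    (hDsucc : ∀ (d : ℕ) (Γ : Scheme.{0}) (y : Γ), IsClosed (({y} : Set Γ)) →
      (D (d + 1) Γ y ↔ ∀ (hy : IsClosed (({y} : Set Γ))) (Z : Scheme.{0}) (τ : Z ⟶ Γ), IsBlowup τ (vanishingIdeal ⟨{y}, hy⟩) →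
        ∃ S' : Finset Z, (∀ z : Z, τ z = y → z ∉ S' → IsRegularLocalRing (Z.presheaf.stalk z)) ∧
          ∀ z ∈ S', τ z = y ∧ IsClosed (({z} : Set Z)) ∧ ∃ d' ≤ d, D d' Z z)) (j : ℕ) :
    ∀ (f : MvPolynomial (Fin 3) K), f = X 0 ^ 3 + X 1 ^ (j + 6) + X 2 ^ 2 →
      ∀ (y₀ : Spec (CommRingCat.of (MvPolynomial (Fin 3) K ⧸ Ideal.span {f}))),
        y₀.asIdeal = Ideal.map (Ideal.Quotient.mk (Ideal.span {f})) (Ideal.span (Set.range (X : Fin 3 → MvPolynomial (Fin 3) K))) →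
        ∀ n, ¬ D n (Spec (CommRingCat.of (MvPolynomial (Fin 3) K ⧸ Ideal.span {f}))) y₀ := by
  classical
  intro f hf y₀ hy₀ n
  have e : (X 2 ^ 2 : MvPolynomial (Fin 3) K) + (X 0 ^ 3 + X 1 ^ (j + 6)) = f := by rw [hf]; ring
  subst e
  have hΦ : (X 2 ^ 2 : MvPolynomial (Fin 3) K).IsHomogeneous 2 := isHomogeneous_X_pow (2 : Fin 3) 2
  have hΦ0 : (X 2 ^ 2 : MvPolynomial (Fin 3) K) ≠ 0 := pow_ne_zero _ (X_ne_zero 2)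
  have hΨ : (X 0 ^ 3 + X 1 ^ (j + 6) : MvPolynomial (Fin 3) K) ∈ Ideal.span (Set.range (X : Fin 3 → MvPolynomial (Fin 3) K)) ^ (2 + 1) := by
    refine Ideal.add_mem _ ?_ ?_
    · simpa using SecondOrderPoint.monomial_mem_pow₃ K 3 0 0 (k := 2 + 1) (by norm_num)
    · simpa using SecondOrderPoint.monomial_mem_pow₃ K 0 (j + 6) 0 (k := 2 + 1) (by omega)
  let 𝔪 : Ideal (MvPolynomial (Fin 3) K) := Ideal.span (Set.range fun i : Fin 3 => (X i - C ((0 : Fin 3 → K) i) : MvPolynomial (Fin 3) K))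
  have hX : ∀ i : Fin 3, (X i : MvPolynomial (Fin 3) K) ∈ 𝔪 := fun i => by
    have h : (X i - C ((0 : Fin 3 → K) i) : MvPolynomial (Fin 3) K) ∈ 𝔪 := Ideal.subset_span ⟨i, rfl⟩
    simpa using h
  have hG2 : (X 2 ^ 2 + (X 0 ^ 3 * X 1 + X 1 ^ (j + 4)) : MvPolynomial (Fin 3) K) ∈ 𝔪 ^ 2 := by
    refine Ideal.add_mem _ (Ideal.pow_mem_pow (hX 2) 2) (Ideal.add_mem _ ?_ ?_)
    · rw [pow_two]
      exact Ideal.mul_mem_mul (Ideal.mul_mem_left _ _ (hX 0)) (hX 1)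
    · exact Ideal.pow_le_pow_right (by omega : 2 ≤ j + 4) (Ideal.pow_mem_pow (hX 1) (j + 4))
  have hG0 : (X 2 ^ 2 + (X 0 ^ 3 * X 1 + X 1 ^ (j + 4)) : MvPolynomial (Fin 3) K) ≠ 0 := by
    intro h
    have h1 := congrArg (eval (Pi.single (2 : Fin 3) (1 : K))) h
    simp at h1
  have hGH : aeval (fun i : Fin 3 => X i + C ((0 : Fin 3 → K) i)) (X 2 ^ 2 + (X 0 ^ 3 * X 1 + X 1 ^ (j + 4)) : MvPolynomial (Fin 3) K) =
      X 2 ^ 2 + (X 0 ^ 3 * X 1 + X 1 ^ (j + 4)) := SecondOrderPoint.aeval_translate_zero K _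
  exact towerLevel_none_origin_of_mark K D hD0 hDsucc (X 2 ^ 2) (X 0 ^ 3 + X 1 ^ (j + 6)) (by norm_num) hΦ hΦ0 hΨ 1 _ hG0
    (x2y3zk_strictTransform₁ K j) 0 (hX 1) hG2 _ hGH (fun y' hy' m => towerLevel_none_origin_x2y3z_blowup K D hD0 hDsucc j _ (by ring) y' hy' m) y₀ hy₀ n

end OneStep

end Summit.ResolutionOfSingularities.ResolutionOfSingularities.Cruxes.EquisingularLiftNat.Sections

end
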